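import Summits.QuantumFields.BalabanUV.T4Continuum.Spine.NE1p.DressedJointAnalyticOnCores
import Summits.QuantumFields.BalabanUV.T4Continuum.Spine.NE1p.DressedSmallFieldGeometryFaces

/-!
# T⁴ programme, spine estimate NE1′ (node O3b/H2) — S42's JOINT (OPERATOR DATUM, SOURCE) SMALL-FIELD ENDs ON THE TORUS OF THE
# PAPERS: joint holomorphy in (operator datum, source) + the (2.41) envelope of the dressed output built from (2.14)-cores with
# term-dependent polymer families, and of the substrate's slot activities, at pv22's `tgeometry 4 N` — NO geometry hypothesis,
# constants LOCATED as numerals (ν = 9, κ₀ = 64·log 162, K₀ = K₀(64,8), c₁ = 64, b = 5·r₁)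

Cell `pub-balaban`, sub-cell `t4`, BINDER-OWNERS row NE1′; NE1′ formalisation crew, unit `b2b-balaban-t4-ne1p-formalise-leaf-03`
(LEAF PROVER 03, generation 13); crew row S⟨next⟩ of `t4/formal/NE1p/LEAVES.md` (own-lineage follower of S42 `DressedJointAnalyticOnCores`
(p233022) in its own scope — the FACE column on the tori closed out for S42, as S37 `DressedSourceAnalyticOnCoresTorus` (p231648) did
for S33).  ADDITIVE — imports S42 `Spine/NE1p/DressedJointAnalyticOnCores` (→ S33 → N0r∕N0q∕N0p∕N0n, row NE5's
`OutputRateOpGaussianParam` ∕ `B13TermParamGaussianBi{,Prod}`, the substrate's `SubstrateActivities`) and S24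
`Spine/NE1p/DressedSmallFieldGeometryFaces` (`K₀_four`; → N0o `DressedSmallFieldGeometry.torus_consts`) ONLY; THEOREMS ONLY (0 def,
0 `def … : Prop`, 0 cite); nothing of S42 ∕ S33 ∕ N0n–N0r ∕ S24 ∕ row NE5 ∕ the substrate ∕ pv22 is restated — their declarations are
used BY NAME.

WHY THIS FILE.  S42 §4∕§5 fired N0n's parametric-analyticity END at the parameter space `Op × ℂ` — JOINT holomorphy of the dressed
small-field output in (operator datum, source) on `ball (ctr k g U).1 (ROp k) ×ˢ ball 0 μ₁` with the (2.41) envelope, (E1) discharged in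
BOTH species (§1 `differentiableOn_termAt_joint`), (E2) by the o-UNIFORM letter mass — over a general `B13Resummation.Geometry D Cube`.
Every other small-field END of the crew has, next to its `Geometry` form, a TORUS form at pv22's CONSTRUCTED carrier geometry
`tgeometry 4 N` with the (B4) group discharged BY NAME and the (B5) clauses located as numerals (S24 §2, S25 §2, S27–S29, S31, S34,
S36–S39); S37 supplied them for S33's fixed-operator ENDs.  This file supplies the two torus forms of S42:
* §1 `analytic_and_bounded_locE_opSource_of_coresAt_pencil_mass_torus` — S42 §4 ONCE BY NAME at `D := tsys 4 N`, `G := tgeometry 4 N`,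
  `b₅ := 5·r₁`, constants by `torus_consts` ∕ `K₀_four` (cores `𝔊 k i X : BiCore P (dom k i) Op (β k i) (α k i)` with TERM-DEPENDENT
  polymer families, operator letters on the OPEN letter ball `ball (ctr k g U).1 (R′ k)` + the room `ROp k < R′ k`, SOURCE pencil
  `h₀ + s • v`, (B3) as N0q's letter budget `hM3`);
* §2 `analytic_and_bounded_locE_opSource_of_actOfLetters_torus` — S42 §5 ONCE BY NAME (the substrate's letters
  `ℓ : ∀ Z j, CoreLetters P Op 𝒴 dom Jc V Z j`, term index `Pol × J`, `hact` by `rfl` inside S42).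
Conclusions in the crew's torus currency: `(o, s) ↦ E[act (o, s)](X₀)` complex differentiable on `ball (ctr k g U).1 (ROp k) ×ˢ ball 0 μ₁`
and bounded there by `e·9·64·K₀(64,8)²·A·e^{−r₁·torusTreeLen X₀}` (S24 `norm_locE_le_torus` ∕ S25 `analytic_and_bounded_locE_param_torus` ∕
S37's RHS LITERALLY).  Binder census vs S42 §4∕§5: MINUS [D, Cube, G, b₅, hb], PLUS [N, [NeZero N]]; CHANGED = the torus dictionary only
(`G.κ₀ ↦ 64·log 162`, `G.K₀·G.ν·G.c₁ ↦ K₀ 64 8 · 9 · 64` with `b₅ ↦ 5·r₁`, `G.cubes Z ⊆ G.cubes X₀ ↦ Z.1 ⊆ X₀.1`, `D.dj ↦ torusTreeLen ·.1`);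
vs S37 §1∕§2's fixed-operator torus ENDs: MINUS [o, hO], `hact` quantified over the parameter set, conclusion on the product ball.
S42's import cone carries no `TwoRuns` instance (S33 → N0r → `SubstrateActivities` only), so the bare `locE (TTouch …)` text elaborates
classically exactly as S37's — no `(Dom := …)` pin needed (crew note R-T123 (vii)).

HONEST FRAMING.  By-name kernel composition: S42's two joint ENDs re-socketed on pv22's CONSTRUCTED torus ((B4) discharged BY NAME there;
pv22's READING of 𝐃_{k+1}∕d_{k+1} (D-pv22.3) not asserted); (B1a) kernel in BOTH species as in S42 — a relocation onto the Gaussian LETTER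
hypotheses `hN`∕`hq` (rows NE2∕NE3's data as row NE5 displays them), NOT onto Bałaban's (2.14): the identification of Bałaban's resummed
terms with such cores is the substrate's DISPLAYED reading (NE5 LEAVES class W), NOT claimed; (B1b)'s residue (`terms`∕`emb`∕`hscale`),
(B3) = `hM3` (G-ne9p2-5 UNPRINTED, shared with NE9), the operator-letter blocks, the located clause SHAPES «κ large» ∕ «ε₁ small» and `hH`
stay DISPLAYED; `9`, `64`, `64·log 162`, `K₀ 64 8` are pv22's PROVED constants entering BY NAME, `5·r₁` N0o's convention — no numeral of
[Balaban1988RGII]; 0 binders instantiated on Bałaban's densities; no new inequality; no wall item of NE1′ or NE5 moves; wall v1.7 (T4-DAG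
v46) does NOT move; R-t4r2-Q2 NOT met.  NE1′ ⇐ the named binders — NOT proved, NOT printed; spine PROVED 0∕9; count 9 unchanged.  Rung
(B)+1 on ONE finite four-torus — NOT infinite volume, NOT a mass gap, NOT OS on ℝ⁴, NOT Clay.  HONEST DEPENDENCY: continuum YM on T⁴ ⇐
BetaPertH ∧ nine spine estimates (0/9 proved); BetaPertH ⇐ (D1) ∧ (D4) ∧ CAP+tail; G-an2-4 gates asym, D1 and NE2/3/4.
-/

noncomputable section

namespace Summit.QuantumFields.BalabanUV.T4Continuum.NE1p.DressedJointAnalyticOnCoresTorus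

open Metric Set Complex MeasureTheory
open scoped BigOperators
open Literature.MathematicalPhysics.QuantumFieldTheory.Balaban1983to89.T4OutputRate (Carriers)
open Literature.MathematicalPhysics.QuantumFieldTheory.Balaban1983to89.B13Resummation (locE)
open Literature.MathematicalPhysics.QuantumFieldTheory.Balaban1983to89.TreeLengthTorus (tsys torusTreeLen)
open Literature.MathematicalPhysics.QuantumFieldTheory.Balaban1983to89.TreeLengthTorusGeometry (TTouch tgeometry)
open Literature.MathematicalPhysics.QuantumFieldTheory.Balaban1983to89.B12TreeDecay (K₀)
open Summit.QuantumFields.BalabanUV.T4Continuum.B13HistMeasurable (MeasPotFrame B13HistM)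
open Summit.QuantumFields.BalabanUV.T4Continuum.B13TermParamGaussianBi (BiCore)
open Summit.QuantumFields.BalabanUV.T4Continuum.SubstrateActivities (CoreLetters coreOf actOfLetters)
open Summit.QuantumFields.BalabanUV.T4Continuum.NE1p.DressedJointAnalyticOnCores
  (analytic_and_bounded_locE_opSource_of_coresAt_pencil_mass analytic_and_bounded_locE_opSource_of_actOfLetters)
open Summit.QuantumFields.BalabanUV.T4Continuum.NE1p.DressedSmallFieldGeometry (torus_consts)
open Summit.QuantumFields.BalabanUV.T4Continuum.NE1p.DressedSmallFieldGeometryFaces (K₀_four)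

variable {N : ℕ} [NeZero N]

/-! ## §1 CORES WITH TERM-DEPENDENT POLYMER FAMILIES: joint holomorphy in (operator datum, source) ON THE TORUS -/

section Dep

variable {C : Carriers} {P : MeasPotFrame C} {Op : Type*} [NormedAddCommGroup Op] [NormedSpace ℂ Op] {ι : Type*}
  {𝒴 : ℕ → ι → Type*} {dom : ∀ k i, 𝒴 k i → C.Dom} {β : ℕ → ι → Type*} [∀ k i, MeasurableSpace (β k i)]
  {α : ℕ → ι → Type*} [∀ k i, NormedAddCommGroup (α k i)] [∀ k i, InnerProductSpace ℝ (α k i)]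
  [∀ k i, FiniteDimensional ℝ (α k i)] [∀ k i, MeasurableSpace (α k i)] [∀ k i, BorelSpace (α k i)]

open Classical in
/-- **JOINT HOLOMORPHY IN (OPERATOR DATUM, SOURCE) + THE (2.41) ENVELOPE FOR CORES WITH TERM-DEPENDENT POLYMER FAMILIES, ON THE
TORUS — NO GEOMETRY HYPOTHESIS** (kernel; S42 §4 `analytic_and_bounded_locE_opSource_of_coresAt_pencil_mass` ONCE BY NAME at `tsys 4 N` ∕
`tgeometry 4 N`, `b₅ := 5·r₁`, constants located by `torus_consts` ∕ `K₀_four`).  Binders = S37 §1's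
`analytic_and_bounded_locE_of_coresAt_pencil_mass_torus` WITHOUT `o`∕`hO` (the operator datum ranges over the open class ball), `hact`
quantified over the parameter set.  Conclusion: `(o, s) ↦ E[Σ_i termAt o (h₀ + s • v)](X₀)` is complex differentiable on
`ball (ctr k g U).1 (ROp k) ×ˢ ball 0 μ₁` and bounded there by `e·9·64·K₀(64,8)²·A·e^{−r₁·torusTreeLen X₀}`. [folklore] -/
theorem analytic_and_bounded_locE_opSource_of_coresAt_pencil_mass_torus {W : Set (ℕ → ℝ)}
    {ctr : ℕ → (ℕ → ℝ) → C.BgB → Op × B13HistM P} {ROp RHist R' : ℕ → ℝ}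
    (𝔊 : ∀ k i, C.Dom → BiCore P (dom k i) Op (β k i) (α k i)) {mq bq N₀ : ℕ → ι → C.Dom → ℝ} (hroom : ∀ k, ROp k < R' k)
    (hm : ∀ k, ∀ g ∈ W, ∀ (U : C.BgB) (X : C.Dom), C.scale X = k → ∀ i, 0 < mq k i X)
    (hN : ∀ k, ∀ g ∈ W, ∀ (U : C.BgB) (X : C.Dom), C.scale X = k → ∀ i,
      (∀ o ∈ ball (ctr k g U).1 (R' k), AEStronglyMeasurable ((𝔊 k i X).N o) (𝔊 k i X).lam) ∧
      (∀ p, DifferentiableOn ℂ (fun o => (𝔊 k i X).N o p) (ball (ctr k g U).1 (R' k))) ∧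
      (∀ o ∈ ball (ctr k g U).1 (R' k), ∀ p, ‖(𝔊 k i X).N o p‖ ≤ N₀ k i X))
    (hq : ∀ k, ∀ g ∈ W, ∀ (U : C.BgB) (X : C.Dom), C.scale X = k → ∀ i,
      (∀ o ∈ ball (ctr k g U).1 (R' k),
        AEStronglyMeasurable (Function.uncurry ((𝔊 k i X).q o)) ((𝔊 k i X).lam.prod volume)) ∧
      (∀ p v, DifferentiableOn ℂ (fun o => (𝔊 k i X).q o p v) (ball (ctr k g U).1 (R' k))) ∧
      (∀ o ∈ ball (ctr k g U).1 (R' k), ∀ p v, mq k i X * ‖v‖ ^ 2 - bq k i X ≤ ((𝔊 k i X).q o p v).re))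
    {k : ℕ} {g : ℕ → ℝ} (hg : g ∈ W) {U : C.BgB} {h₀ v : B13HistM P} {μ₁ : ℝ}
    (hH : ‖h₀ - (ctr k g U).2‖ + μ₁ * ‖v‖ ≤ RHist k)
    {emb : (tsys 4 N).Dom → C.Dom} (hscale : ∀ Z, C.scale (emb Z) = k) {terms : (tsys 4 N).Dom → Finset ι}
    {act : Op × ℂ → (tsys 4 N).Dom → ℂ}
    (hact : ∀ p ∈ ball (ctr k g U).1 (ROp k) ×ˢ ball (0 : ℂ) μ₁, ∀ Z,
      act p Z = ∑ i ∈ terms Z, (𝔊 k i (emb Z)).termAt p.1 (h₀ + p.2 • v))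
    {A R r₁ : ℝ} (X₀ : (tsys 4 N).Dom) (hA : 0 ≤ A) (hr₁ : 0 ≤ r₁)
    (hrate : r₁ + 2 * (64 * Real.log 162) + 2 ≤ R) (hsmall : A * Real.exp (5 * r₁ + 1) * K₀ 64 8 * 9 * 64 ≤ 1)
    (hM3 : ∀ Z : (tsys 4 N).Dom, Z.1 ⊆ X₀.1 →
      ∑ i ∈ terms Z, (𝔊 k i (emb Z)).lam.real univ * ((𝔊 k i (emb Z)).wB * N₀ k i (emb Z) *
          Real.exp (bq k i (emb Z))) * (Real.pi / (mq k i (emb Z) / 2)) ^ (Module.finrank ℝ (α k i) / 2 : ℝ) *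
        Real.exp ((𝔊 k i (emb Z)).N₁ * (‖h₀‖ + μ₁ * ‖v‖)) ≤ A * Real.exp (-(R * torusTreeLen Z.1))) :
    DifferentiableOn ℂ (fun p => locE (TTouch (d := 4) (N := N)) (fun Z : (tsys 4 N).Dom => Z.1) (act p) X₀.1)
        (ball (ctr k g U).1 (ROp k) ×ˢ ball (0 : ℂ) μ₁) ∧
      ∀ p ∈ ball (ctr k g U).1 (ROp k) ×ˢ ball (0 : ℂ) μ₁,
        ‖locE (TTouch (d := 4) (N := N)) (fun Z : (tsys 4 N).Dom => Z.1) (act p) X₀.1‖ ≤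
          Real.exp 1 * 9 * 64 * K₀ 64 8 ^ 2 * A * Real.exp (-(r₁ * torusTreeLen X₀.1)) := by
  obtain ⟨hν, hκ, hc⟩ := torus_consts N
  have hK₀ := K₀_four (N := N)
  have h := analytic_and_bounded_locE_opSource_of_coresAt_pencil_mass (tsys 4 N) (tgeometry 4 N) 𝔊 hroom hm hN hq hg hH hscale
    hact (R := R) (b₅ := 5 * r₁) (X₀ := X₀) hA hr₁ (le_of_eq (by ring)) (by rw [hκ]; exact hrate)
    (by rw [hK₀, hν, hc]; exact hsmall) hM3
  rw [hν, hc, hK₀] at h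
  exact h

end Dep

/-! ## §2 THE SUBSTRATE'S SLOT ACTIVITIES: joint holomorphy in (operator datum, source) ON THE TORUS -/

section Slot

variable {C : Carriers} (P : MeasPotFrame C) (Op : Type*) [NormedAddCommGroup Op] [NormedSpace ℂ Op] {Pol J : Type*}
  (𝒴 : Pol → J → Type) [∀ Z j, Fintype (𝒴 Z j)] (dom : ∀ Z j, 𝒴 Z j → C.Dom)
  (Jc : Pol → J → Type) [∀ Z j, Fintype (Jc Z j)]
  (V : Pol → J → Type) [∀ Z j, NormedAddCommGroup (V Z j)] [∀ Z j, InnerProductSpace ℝ (V Z j)]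
  [∀ Z j, MeasurableSpace (V Z j)] [∀ Z j, BorelSpace (V Z j)] [∀ Z j, FiniteDimensional ℝ (V Z j)]

open Classical in
/-- **JOINT HOLOMORPHY IN (OPERATOR DATUM, SOURCE) + THE (2.41) ENVELOPE OF THE DRESSED OUTPUT OF THE SLOT ACTIVITIES, ON THE TORUS —
NO GEOMETRY HYPOTHESIS** (kernel; S42 §5 `analytic_and_bounded_locE_opSource_of_actOfLetters` ONCE BY NAME at `tgeometry 4 N`, constants
located).  Binders = S37 §2's `analytic_and_bounded_locE_of_actOfLetters_torus` WITHOUT `o`∕`hO`.  Conclusion: `(o, s) ↦ E[Σ_{p ∈ terms Z}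
actOfLetters ℓ p.1 p.2 o (h₀ + s • v)](X₀)` is complex differentiable on `ball (ctr k g U).1 (ROp k) ×ˢ ball 0 μ₁` and bounded there by
`e·9·64·K₀(64,8)²·A·e^{−r₁·torusTreeLen X₀}`. [folklore] -/
theorem analytic_and_bounded_locE_opSource_of_actOfLetters_torus {W : Set (ℕ → ℝ)}
    {ctr : ℕ → (ℕ → ℝ) → C.BgB → Op × B13HistM P} {ROp RHist R' : ℕ → ℝ} (ℓ : ∀ Z j, CoreLetters P Op 𝒴 dom Jc V Z j)
    {mq bq N₀ : ℕ → Pol × J → C.Dom → ℝ} (hroom : ∀ k, ROp k < R' k)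
    (hm : ∀ k, ∀ g ∈ W, ∀ (U : C.BgB) (X : C.Dom), C.scale X = k → ∀ p, 0 < mq k p X)
    (hN : ∀ k, ∀ g ∈ W, ∀ (U : C.BgB) (X : C.Dom), C.scale X = k → ∀ p : Pol × J,
      (∀ o ∈ ball (ctr k g U).1 (R' k),
        AEStronglyMeasurable ((ℓ p.1 p.2).N o) (coreOf P Op 𝒴 dom Jc V ℓ p.1 p.2).lam) ∧
      (∀ a, DifferentiableOn ℂ (fun o => (ℓ p.1 p.2).N o a) (ball (ctr k g U).1 (R' k))) ∧
      (∀ o ∈ ball (ctr k g U).1 (R' k), ∀ a, ‖(ℓ p.1 p.2).N o a‖ ≤ N₀ k p X))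
    (hq : ∀ k, ∀ g ∈ W, ∀ (U : C.BgB) (X : C.Dom), C.scale X = k → ∀ p : Pol × J,
      (∀ o ∈ ball (ctr k g U).1 (R' k),
        AEStronglyMeasurable (Function.uncurry ((ℓ p.1 p.2).q o))
          ((coreOf P Op 𝒴 dom Jc V ℓ p.1 p.2).lam.prod volume)) ∧
      (∀ a v, DifferentiableOn ℂ (fun o => (ℓ p.1 p.2).q o a v) (ball (ctr k g U).1 (R' k))) ∧
      (∀ o ∈ ball (ctr k g U).1 (R' k), ∀ a v, mq k p X * ‖v‖ ^ 2 - bq k p X ≤ ((ℓ p.1 p.2).q o a v).re))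
    {k : ℕ} {g : ℕ → ℝ} (hg : g ∈ W) {U : C.BgB} {h₀ v : B13HistM P} {μ₁ : ℝ}
    (hH : ‖h₀ - (ctr k g U).2‖ + μ₁ * ‖v‖ ≤ RHist k)
    {emb : (tsys 4 N).Dom → C.Dom} (hscale : ∀ Z, C.scale (emb Z) = k) (terms : (tsys 4 N).Dom → Finset (Pol × J))
    {A R r₁ : ℝ} (X₀ : (tsys 4 N).Dom) (hA : 0 ≤ A) (hr₁ : 0 ≤ r₁)
    (hrate : r₁ + 2 * (64 * Real.log 162) + 2 ≤ R) (hsmall : A * Real.exp (5 * r₁ + 1) * K₀ 64 8 * 9 * 64 ≤ 1)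
    (hM3 : ∀ Z : (tsys 4 N).Dom, Z.1 ⊆ X₀.1 →
      ∑ p ∈ terms Z, (coreOf P Op 𝒴 dom Jc V ℓ p.1 p.2).lam.real univ *
          ((coreOf P Op 𝒴 dom Jc V ℓ p.1 p.2).wB * N₀ k p (emb Z) * Real.exp (bq k p (emb Z))) *
          (Real.pi / (mq k p (emb Z) / 2)) ^ (Module.finrank ℝ (V p.1 p.2) / 2 : ℝ) *
        Real.exp ((coreOf P Op 𝒴 dom Jc V ℓ p.1 p.2).N₁ * (‖h₀‖ + μ₁ * ‖v‖)) ≤ A * Real.exp (-(R * torusTreeLen Z.1))) :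
    DifferentiableOn ℂ (fun z : Op × ℂ => locE (TTouch (d := 4) (N := N)) (fun Z : (tsys 4 N).Dom => Z.1)
        (fun Z => ∑ p ∈ terms Z, actOfLetters P Op 𝒴 dom Jc V ℓ p.1 p.2 z.1 (h₀ + z.2 • v)) X₀.1)
        (ball (ctr k g U).1 (ROp k) ×ˢ ball (0 : ℂ) μ₁) ∧
      ∀ z ∈ ball (ctr k g U).1 (ROp k) ×ˢ ball (0 : ℂ) μ₁, ‖locE (TTouch (d := 4) (N := N)) (fun Z : (tsys 4 N).Dom => Z.1)
          (fun Z => ∑ p ∈ terms Z, actOfLetters P Op 𝒴 dom Jc V ℓ p.1 p.2 z.1 (h₀ + z.2 • v)) X₀.1‖ ≤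
        Real.exp 1 * 9 * 64 * K₀ 64 8 ^ 2 * A * Real.exp (-(r₁ * torusTreeLen X₀.1)) := by
  obtain ⟨hν, hκ, hc⟩ := torus_consts N
  have hK₀ := K₀_four (N := N)
  have h := analytic_and_bounded_locE_opSource_of_actOfLetters P Op 𝒴 dom Jc V (tsys 4 N) (tgeometry 4 N) ℓ hroom hm hN hq hg hH
    hscale terms (R := R) (b₅ := 5 * r₁) (X₀ := X₀) hA hr₁ (le_of_eq (by ring)) (by rw [hκ]; exact hrate)
    (by rw [hK₀, hν, hc]; exact hsmall) hM3
  rw [hν, hc, hK₀] at h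
  exact h

end Slot

end Summit.QuantumFields.BalabanUV.T4Continuum.NE1p.DressedJointAnalyticOnCoresTorus

end
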